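import Summits.CriticalPhenomena.PercolationContinuityZ3.Theorems.Transplant.SkelFrmBFaceBVC3
import Summits.CriticalPhenomena.PercolationContinuityZ3.Theorems.Transplant.SkelFrmBParamsBridgeFrameF
import Summits.CriticalPhenomena.PercolationContinuityZ3.Theorems.Transplant.SkelFrmBParamsFaceLamA
import Summits.CriticalPhenomena.PercolationContinuityZ3.Theorems.Transplant.SkelFrmBChoiceDefsV
import Summits.CriticalPhenomena.PercolationContinuityZ3.Theorems.Transplant.SkelFrmBParamsSchedA
import HarnessLib
import Summits.CriticalPhenomena.PercolationContinuityZ3.Theorems.Transplant.SkelPhiFaceChainFactLT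
import Summits.CriticalPhenomena.PercolationContinuityZ3.Theorems.Transplant.SkelFrmBChoiceZoneK
import Summits.CriticalPhenomena.PercolationContinuityZ3.Theorems.Transplant.SkelPhiRootRoute
import Summits.CriticalPhenomena.PercolationContinuityZ3.Theorems.Transplant.SkelPhiRootBridgeData

/-!
# N2 (frames-only node, OPEN) — (F) column, THE WRAPPER's LAYER (a4): `NegB.faceOblRM_frmBVC₄` = layer (a3) `faceOblRM_frmBVC₃` WITH THE F-Λ BLOCK, THE BRIDGE
# FRAME's CONSTANT ROWS AND THE LONG NUMBERS' PROOFS DISCHARGED (hp-8 g44; generated by bin/gen_btc4v.py)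
N1's layer B3 minus the bridge inputs: `Λ₀ Λ₁ := KS.ΛF₀ / ΛF₁` with `hΛR/hΛQ0/hΛQ1/hkA0/hkA1` by hp-8 g42's FaceLamA (`hΛR_F` at the same-orientation frame `σ := 1`,
`hΛQ_F`, `hkF0_RA/hkF1_RA`) and the zone bound `hΛZ` from `M_u ≤ e_F` (`M_u < R'0`); `kb := M_u`, `hclr₁` by `hclr₁_BF` (box floors `22000·(R'0+2) ≤ M_L`,
`16·S_F ≤ M_L` from `slotsF_hyps`); `hπ1` by `core1LoF_l1` under the row `YbF ≤ r` (new binder `hYbr`); the one bridge frame `B := KS.BFs … 1` is `BridgeOK`,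
`Rlev0 + 1 ≤ R′`, contains the hop box (`BF_ok/BF_R'_ge/hB0_F`) at the bridge pair's clause (`clauseP_of_atQT` ∘ `bridgeF_adm`, `ℓBF_ge ⇒ 27 ≤ ℓBF`); the bridge
kit's three level-width rows by `Skelφ.icc_level_room` on `B₀lo ≤ B₀hi` (`BF_shared`) and `KS0.levels_wide`, `hEb` by `R'0 = j₁0 + reach0 + 1 ≤ R′`; the long
numbers' `hnL hvL hmf hlay` (`one_le_of_eqNumL`, `EqNumL.v_le`, `prFA_pos`, `|h_L| ≤ 10 n_L ∧ 11 ≤ ℓ_L`), `hA0` (`prFA_pos`), `hΔg` (`Φ.degree_le`), `hclrz`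
(`EqNumL.layer` + `M_u + 3 ≤ M_L`).  KEPT for the next layer / the wrapper: the bridge INPUTS `Qb Fb hQb hFb hbridge` (+ `Rb`), `hchain/nB`, the slot-floor rows
(`hL' hRlr hRb₀ hr₁R hRr₀ hr₂R hRsr hρr hR₁b hR₁r hr₀L hYbr hMR0`), layer (a2)'s rows, `hgx/hfx/hmx`.  Conclusion BY NAME as (a0)–(a3).
builds on p205010 (kernel theorem, internal audit signed; external expert review pending) — nothing here uses p205010; NOTHING is claimed about the open node
`SamePDropOfSkeletonFrm₁`.
Lane `prim-bschramm`, seat `prim-hp-8` (gen 44); helper file (`--supports stmt-CriticalPhenomena-4575 --as helper`).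
[cite: KozmaNitzan2024, §4 Lemma 10 (pp. 17–21), Lemma 12 (pp. 23–25), Theorem 6 (pp. 25–31)] [cite: MartineauTassion2017, §4.3 Lemma 4.2]
-/

noncomputable section

open scoped Classical ENNReal

namespace Summit.CriticalPhenomena.PercolationContinuityZ3.Theorems.Transplant

namespace PlanarSkeletonFrm

namespace NegB

open MeasureTheory Literature.Probability.Percolation Literature.Probability.LatticeModels SimpleGraph KNCells KNLevels GadgetSystem Contour
open Literature.Probability.Percolation.KozmaNitzan
open Literature.Probability.Percolation.KozmaNitzan.Cells (oth sgOf sgOf_sign stepVec_apply_fst)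
open Literature.Barriers.CriticalPhenomena (graphBall mem_graphBall_self graphBall_mono)
open BoxProdZ2 (ConcRadiiG Erad Frad nQ nS)
open ChainPlanar ChainPara
open Skel (winGraph routeW excess WinStepData)
open SkelI (tanOff)
open TwoAxis.Para (modulus detD rep₂)
open SkelConc (Consts)
open Skelφ
open Skelφ.StepI (DataNS OutNS)
open Neg

variable {κ : Consts} {V : Type} [DecidableEq V] [Countable V] {G : SimpleGraph V} [G.LocallyFinite] {Φ : PlanarSkeletonFrm G} {t : V}
  {p : unitInterval} {Pv : NegB.PSlot} {cv hv : NegB.CSlot} {hC : Φ.CylSubcritical p}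
  {O : OutNS V} {q : unitInterval}

set_option maxHeartbeats 6400000 in
/-- **Layer (a4) of the (F) wrapper at the Q3V tuple: the F-Λ block, the bridge frame's constant rows and the long numbers' proofs discharged**
(see the module docstring). [cite: KozmaNitzan2024, §4 Lemma 12 (pp. 23–25)] -/
theorem faceOblRM_frmBVC₄
    (mk cW : ℕ)
    (gx fx : Neg.FSlot)
    (hgx : ∀ D : DataNS V, gxFc mk cW κ Φ t p D ≤ gx κ Φ t p D)
    (hfx : ∀ D : DataNS V, fxFc mk κ Φ t p D ≤ fx κ Φ t p D)
    (ex mx : GSlot)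
    (hmx : (prFA κ Φ t p O.merged (KS.gT mk gx κ Φ t p O.merged) (KS.fT mk fx κ Φ t p O.merged)).mF (fcellsA κ Φ t p O.merged (KS.gT mk gx κ Φ t p O.merged) (KS.fT mk fx κ Φ t p O.merged)) ≤ (((mx κ Φ t p O.merged (KS.gT mk gx κ Φ t p O.merged) (KS.fT mk fx κ Φ t p O.merged)) : ℕ) : ℤ))
    (hAt : (choiceAtQ3V κ Φ t p Pv (KS.gT mk gx) (KS.fT mk fx) (SUS ex mx) cv hv BSlot.small3 hC).AtQNQ O q)
    (h1 : Φ.types = {t})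
    (hp0 : 0 < (p : ℝ))
    (hp1 : (p : ℝ) < 1)
    (hMR0 : 4 * Neg.K κ * (KS0.R'0 κ Φ t p O.merged mk + 2) ≤ ML κ Φ t p O.merged (KS.gT mk gx κ Φ t p O.merged))
    -- the binders of `faceOblRM_fineNb2V` (schemeO side)
    (hL' : 1 ≤ (Skelφ.Prm.Lp ((SUS ex mx) κ Φ t p O.merged (KS.gT mk gx κ Φ t p O.merged) (KS.fT mk fx κ Φ t p O.merged) q)))
    -- the binders of the keystone `hkits_faceSteps_of_nums6` (kit / route / Λ / numbers)
    {r : ℕ}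
    -- THE ROUTE BLOCK (c-uniform; all signs)
    (hRlr : (RL κ Φ t p O (KS.gT mk gx) (KS.fT mk fx)) ≤ r)
    -- the near-`c` block READ BY THE TWO LATTICE FUNCTIONALS (L-F2): bridge regions (every frame sign), hop prism, zone box, fine extents `kA`
    (nB : ℕ)
    -- the inner-chain fact UP TO THE LENGTH BUDGET `nF` (p3-g11 2026-08-22T02:23:54Z; the wrapper discharges it by `ChainFactF` at `n ≤ LfA K₀`)
    (hchain : ∀ (c : V) (Nr N₃ : ℕ), 0 + 1 + Nr + 1 + N₃ ≤ nB → ∀ (W : Sym2 V → unitInterval) (s : Fin (0 + 1 + Nr + 1 + N₃ + 1) → TStep (winGraph G c r))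
      (T' : Fin (0 + 1 + Nr + 1 + N₃ + 1) → Finset V) (η' : ℝ),
      (∀ i, (s i).L.o = (s 0).L.o) →
      (∀ i : Fin (0 + 1 + Nr + 1 + N₃), T' (Fin.castSucc i) ⊆ (s i.succ).L.X 0) →
      (∀ i, T' i ⊆ (s i).T) →
      (∀ i, (s i).KitsAtF W q Φ.Δ (Neg.δkit κ Φ)) →
      η' ≤ (Neg.δkit κ Φ) / 2 →
      (∀ i, (prodBernoulli W).real (⋃ t ∈ (s i).T \ T' i, openConn (s 0).L.o t) ≤ η') →
      1 - (Neg.δkit κ Φ) < (prodBernoulli W).real (s 0).L.reachB →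
        1 - κ.δ₂ ^ 3 < (prodBernoulli W).real (⋃ t ∈ T' (Fin.last (0 + 1 + Nr + 1 + N₃)), openConn (s 0).L.o t))
    {Rb : ℕ}
    (hRb₀ : (KS0.kit0 t O.merged mk ((((Mu O.merged)) : ℤ) + 2) (KS0.r₀0 t O.merged mk Rb)).r₀ ≤ r)
    (hr₁R : Rb ≤ r)
    (hRr₀ : (KS0.kit0 t O.merged mk (((((Mu O.merged)) + 1 : ℕ) : ℤ) * ((shearUnit (nL κ Φ t p O.merged (KS.gT mk gx κ Φ t p O.merged) (KS.fT mk fx κ Φ t p O.merged)) (prFA κ Φ t p O.merged (KS.gT mk gx κ Φ t p O.merged) (KS.fT mk fx κ Φ t p O.merged)).h) : ℤ) + 1) (KS0.r₀0 t O.merged mk (RL κ Φ t p O (KS.gT mk gx) (KS.fT mk fx)))).r₀ ≤ r)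
    (hr₂R : (RL κ Φ t p O (KS.gT mk gx) (KS.fT mk fx)) ≤ r)
    -- the short region and the zone datum at the kit centres ((S0): inside `Rg`, connected, containing the centre and the fat-prism box `cylBallFin c kz Rk`)
    (hRsr : (KS.Rs t O.merged mk) ≤ r)
    (hρr : (Skelφ.fatRadius Φ.frame hC O.merged.k) ≤ r)
    (Qb Fb : V → Finset V)
    (hQb : ∀ c c', ∀ w ∈ Qb c', w ∈ graphBall G c' Rb ∧
      rootFrame (φL κ Φ t p O.D O.DT.toDataN O.ori (KS.gT mk gx κ Φ t p O.merged) (KS.fT mk fx κ Φ t p O.merged)) c 1 w ∈ Finset.Icc (rootFrame (φL κ Φ t p O.D O.DT.toDataN O.ori (KS.gT mk gx κ Φ t p O.merged) (KS.fT mk fx κ Φ t p O.merged)) c 1 c' - (((KS.BFs κ Φ t p O.merged cW mk (KS.gT mk gx κ Φ t p O.merged) (KS.fT mk fx κ Φ t p O.merged) 1).pr : ℕ) : Site 2)) (rootFrame (φL κ Φ t p O.D O.DT.toDataN O.ori (KS.gT mk gx κ Φ t p O.merged) (KS.fT mk fx κ Φ t p O.merged)) c 1 c' + (((KS.BFs κ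 Φ t p O.merged cW mk (KS.gT mk gx κ Φ t p O.merged) (KS.fT mk fx κ Φ t p O.merged) 1).pr : ℕ) : Site 2)))
    (hFb : ∀ c c', ∀ w ∈ Fb c', w ∈ Qb c' ∧ rootFrame (φL κ Φ t p O.D O.DT.toDataN O.ori (KS.gT mk gx κ Φ t p O.merged) (KS.fT mk fx κ Φ t p O.merged)) c 1 w ∈ Finset.Icc (rootFrame (φL κ Φ t p O.D O.DT.toDataN O.ori (KS.gT mk gx κ Φ t p O.merged) (KS.fT mk fx κ Φ t p O.merged)) c 1 c' + (KS.BFs κ Φ t p O.merged cW mk (KS.gT mk gx κ Φ t p O.merged) (KS.fT mk fx κ Φ t p O.merged) 1).dlo) (rootFrame (φL κ Φ t p O.D O.DT.toDataN O.ori (KS.gT mk gx κ Φ t p O.merged) (KS.fT mk fx κ Φ t p O.merged)) c 1 c' + (KS.BFs κ Φ t p O.merged cW mk (KS.gT mk gx κ Φ t p O.merged) (KS.fT mk fx κ Φ t p O.merged) 1).dhi))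
    (hbridge : ∀ c', 1 - (Neg.δkit κ Φ) ^ 3 < (bondPercolation G q).real (linkIn (↑(Qb c') : Set V) (O.merged.Λ c' O.merged.k) (Fb c')))
    (hR₁b : ((SUS ex mx κ Φ t p O.merged (KS.gT mk gx κ Φ t p O.merged) (KS.fT mk fx κ Φ t p O.merged) q).Rex (Skelφ.fatRadius Φ.frame hC O.merged.k)) ≤ r - (KS0.kit0 t O.merged mk ((((Mu O.merged)) : ℤ) + 2) (KS0.r₀0 t O.merged mk Rb)).r₀)
    (hR₁r : ((SUS ex mx κ Φ t p O.merged (KS.gT mk gx κ Φ t p O.merged) (KS.fT mk fx κ Φ t p O.merged) q).Rex (Skelφ.fatRadius Φ.frame hC O.merged.k)) ≤ r - (KS0.kit0 t O.merged mk (((((Mu O.merged)) + 1 : ℕ) : ℤ) * ((shearUnit (nL κ Φ t p O.merged (KS.gT mk gx κ Φ t p O.merged) (KS.fT mk fx κ Φ t p O.merged)) (prFA κ Φ t p O.merged (KS.gT mk gx κ Φ t p O.merged) (KS.fT mk fx κ Φ t p O.merged)).h) : ℤ) + 1) (KS0.r₀0 t O.merged mk (RL κ Φ t p O (KS.gT mk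 gx) (KS.fT mk fx)))).r₀)
    -- the FACE KIT: constants, exit table rooms, reach, inputs at accuracy `κ.δ₂`
    (hr₀L : (KS0.kit0 t O.merged mk (((((Mu O.merged)) + 1 : ℕ) : ℤ) * (prFA κ Φ t p O.merged (KS.gT mk gx κ Φ t p O.merged) (KS.fT mk fx κ Φ t p O.merged)).D + 1) (KS0.r₀0 t O.merged mk r)).r₀ + 1 ≤ 2 * (Skelφ.Prm.Lp ((SUS ex mx) κ Φ t p O.merged (KS.gT mk gx κ Φ t p O.merged) (KS.fT mk fx κ Φ t p O.merged) q)))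
    -- THE PER-CENTRE NUMBERS (x-faces `du.1 = 0`, y′-faces `du.1 = 1`)
    -- the providers' stride counts within the budget
    -- ONE-SIDED ((R-44)(c)): the numbers' tangential sign is the served sign `1` (one-sided counts `KS.N3WX/N3WY`)
    -- (hp-8 g44) THE NUMBERS BATCH's OWN NODE ROWS: frame rooms at the contact offsets `kEX/kEY` (band `E := Rlev0 + reach0`), the zone bound read by
    -- the two lattice functionals, the one-sided glue rows (x / y′ with `v_L ≥ 0` / y′ with `v_L < 0`), the capacity, the reach budgets, the stride budget
    {kEX kEY : ℤ}
    (hroomX : ∀ du : MDir, du.1 = 0 →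
      (prFA κ Φ t p O.merged (KS.gT mk gx κ Φ t p O.merged) (KS.fT mk fx κ Φ t p O.merged)).Mabs * ((fun du : MDir => (((prFA κ Φ t p O.merged (KS.gT mk gx κ Φ t p O.merged) (KS.fT mk fx κ Φ t p O.merged)).awF₂V (fcellsV κ Φ t p O.merged (KS.gT mk gx κ Φ t p O.merged) (KS.fT mk fx κ Φ t p O.merged) (cOf κ Φ t p O (KS.gT mk gx) (KS.fT mk fx) cv) (hOf κ Φ t p O (KS.gT mk gx) (KS.fT mk fx) hv)) du).toNat)) du + (KS0.Rlev0 κ Φ t p O.merged mk + KS0.reach0 t O.merged mk)) + (prFA κ Φ t p O.merged (KS.gT mk gx κ Φ t p O.merged) (KS.fT mk fx κ Φ t p O.merged)).rdN du.1 ((prFA κ Φ t p O.merged (KS.gT mk gx κ Φ t p O.merged) (KS.fT mk fx κ Φ t p O.merged)).bOf du.1) * ((KS0.Rlev0 κ Φ t p O.merged mk + KS0.reach0 t O.merged mk) + 1) * (prFA κ Φ t p O.merged (KS.gT mk gx κ Φ t p O.merged) (KS.fT mk fx κ Φ t p O.merged)).D ≤ (prFA κ Φ t p O.merged (KS.gT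 mk gx κ Φ t p O.merged) (KS.fT mk fx κ Φ t p O.merged)).rdK du.1 ((prFA κ Φ t p O.merged (KS.gT mk gx κ Φ t p O.merged) (KS.fT mk fx κ Φ t p O.merged)).bOf du.1) * kEX * (prFA κ Φ t p O.merged (KS.gT mk gx κ Φ t p O.merged) (KS.fT mk fx κ Φ t p O.merged)).D)
    (hroomY : ∀ du : MDir, du.1 = 1 →
      (prFA κ Φ t p O.merged (KS.gT mk gx κ Φ t p O.merged) (KS.fT mk fx κ Φ t p O.merged)).Mabs * ((fun du : MDir => (((prFA κ Φ t p O.merged (KS.gT mk gx κ Φ t p O.merged) (KS.fT mk fx κ Φ t p O.merged)).awF₂V (fcellsV κ Φ t p O.merged (KS.gT mk gx κ Φ t p O.merged) (KS.fT mk fx κ Φ t p O.merged) (cOf κ Φ t p O (KS.gT mk gx) (KS.fT mk fx) cv) (hOf κ Φ t p O (KS.gT mk gx) (KS.fT mk fx) hv)) du).toNat)) du + (KS0.Rlev0 κ Φ t p O.merged mk + KS0.reach0 t O.merged mk)) + (prFA κ Φ t p O.merged (KS.gT mk gx κ Φ t p O.merged) (KS.fT mk fx κ Φ t p O.merged)).rdN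 du.1 ((prFA κ Φ t p O.merged (KS.gT mk gx κ Φ t p O.merged) (KS.fT mk fx κ Φ t p O.merged)).bOf du.1) * ((KS0.Rlev0 κ Φ t p O.merged mk + KS0.reach0 t O.merged mk) + 1) * (prFA κ Φ t p O.merged (KS.gT mk gx κ Φ t p O.merged) (KS.fT mk fx κ Φ t p O.merged)).D ≤ (prFA κ Φ t p O.merged (KS.gT mk gx κ Φ t p O.merged) (KS.fT mk fx κ Φ t p O.merged)).rdK du.1 ((prFA κ Φ t p O.merged (KS.gT mk gx κ Φ t p O.merged) (KS.fT mk fx κ Φ t p O.merged)).bOf du.1) * kEY * (prFA κ Φ t p O.merged (KS.gT mk gx κ Φ t p O.merged) (KS.fT mk fx κ Φ t p O.merged)).D)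
    (hZk : ∀ (c' : V) (du : MDir), ∀ v ∈ O.merged.Λ c' (Mu O.merged), |(prFA κ Φ t p O.merged (KS.gT mk gx κ Φ t p O.merged) (KS.fT mk fx κ Φ t p O.merged)).ψ (φL κ Φ t p O.D O.DT.toDataN O.ori (KS.gT mk gx κ Φ t p O.merged) (KS.fT mk fx κ Φ t p O.merged)) c' v du.1| ≤ (fun i : Fin 2 => if i = 0 then KS.kF₀A κ Φ t p O.merged cW mk (KS.gT mk gx κ Φ t p O.merged) (KS.fT mk fx κ Φ t p O.merged) else KS.kF₁A κ Φ t p O.merged cW mk (KS.gT mk gx κ Φ t p O.merged) (KS.fT mk fx κ Φ t p O.merged)) du.1)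
    (hkEr : kEX + ((fcellsV κ Φ t p O.merged (KS.gT mk gx κ Φ t p O.merged) (KS.fT mk fx κ Φ t p O.merged) (cOf κ Φ t p O (KS.gT mk gx) (KS.fT mk fx) cv) (hOf κ Φ t p O (KS.gT mk gx) (KS.fT mk fx) hv)).r 1 : ℤ) ≤ 5 * ((fcellsV κ Φ t p O.merged (KS.gT mk gx κ Φ t p O.merged) (KS.fT mk fx κ Φ t p O.merged) (cOf κ Φ t p O (KS.gT mk gx) (KS.fT mk fx) cv) (hOf κ Φ t p O (KS.gT mk gx) (KS.fT mk fx) hv)).r 1 : ℤ))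
    (hkE2 : 2 * (kEX + ((fcellsV κ Φ t p O.merged (KS.gT mk gx κ Φ t p O.merged) (KS.fT mk fx κ Φ t p O.merged) (cOf κ Φ t p O (KS.gT mk gx) (KS.fT mk fx) cv) (hOf κ Φ t p O (KS.gT mk gx) (KS.fT mk fx) hv)).r 1 : ℤ)) + 8 * KS.u₁A κ Φ t p O.merged (KS.gT mk gx κ Φ t p O.merged) (KS.fT mk fx κ Φ t p O.merged) + 8 + 2 * ((fcellsV κ Φ t p O.merged (KS.gT mk gx κ Φ t p O.merged) (KS.fT mk fx κ Φ t p O.merged) (cOf κ Φ t p O (KS.gT mk gx) (KS.fT mk fx) cv) (hOf κ Φ t p O (KS.gT mk gx) (KS.fT mk fx) hv)).c 0 : ℤ) ≤ 5 * ((fcellsV κ Φ t p O.merged (KS.gT mk gx κ Φ t p O.merged) (KS.fT mk fx κ Φ t p O.merged) (cOf κ Φ t p O (KS.gT mk gx) (KS.fT mk fx) cv) (hOf κ Φ t p O (KS.gT mk gx) (KS.fT mk fx) hv)).r 1 : ℤ))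
    (hfwdX : 2 * kEX + ((fcellsV κ Φ t p O.merged (KS.gT mk gx κ Φ t p O.merged) (KS.fT mk fx κ Φ t p O.merged) (cOf κ Φ t p O (KS.gT mk gx) (KS.fT mk fx) cv) (hOf κ Φ t p O (KS.gT mk gx) (KS.fT mk fx) hv)).hF 0 : ℤ) - (fcellsV κ Φ t p O.merged (KS.gT mk gx κ Φ t p O.merged) (KS.fT mk fx κ Φ t p O.merged) (cOf κ Φ t p O (KS.gT mk gx) (KS.fT mk fx) cv) (hOf κ Φ t p O (KS.gT mk gx) (KS.fT mk fx) hv)).hB 0 + 6 * KS.u₁A κ Φ t p O.merged (KS.gT mk gx κ Φ t p O.merged) (KS.fT mk fx κ Φ t p O.merged) ≤ 2 * (((fcellsV κ Φ t p O.merged (KS.gT mk gx κ Φ t p O.merged) (KS.fT mk fx κ Φ t p O.merged) (cOf κ Φ t p O (KS.gT mk gx) (KS.fT mk fx) cv) (hOf κ Φ t p O (KS.gT mk gx) (KS.fT mk fx) hv)).c 0 : ℤ) + (KS.bwX κ Φ t p O.merged (KS.gT mk gx κ Φ t p O.merged) (KS.fT mk fx κ Φ t p O.merged))))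
    (hkE : kEY + ((fcellsV κ Φ t p O.merged (KS.gT mk gx κ Φ t p O.merged) (KS.fT mk fx κ Φ t p O.merged) (cOf κ Φ t p O (KS.gT mk gx) (KS.fT mk fx) cv) (hOf κ Φ t p O (KS.gT mk gx) (KS.fT mk fx) hv)).r 0 : ℤ) ≤ 5 * ((fcellsV κ Φ t p O.merged (KS.gT mk gx κ Φ t p O.merged) (KS.fT mk fx κ Φ t p O.merged) (cOf κ Φ t p O (KS.gT mk gx) (KS.fT mk fx) cv) (hOf κ Φ t p O (KS.gT mk gx) (KS.fT mk fx) hv)).r 0 : ℤ))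
    (hkE8 : kEY + ((fcellsV κ Φ t p O.merged (KS.gT mk gx κ Φ t p O.merged) (KS.fT mk fx κ Φ t p O.merged) (cOf κ Φ t p O (KS.gT mk gx) (KS.fT mk fx) cv) (hOf κ Φ t p O (KS.gT mk gx) (KS.fT mk fx) hv)).r 0 : ℤ) + 8 * KS.u₀A κ Φ t p O.merged (KS.gT mk gx κ Φ t p O.merged) (KS.fT mk fx κ Φ t p O.merged) + 8 + (fcellsV κ Φ t p O.merged (KS.gT mk gx κ Φ t p O.merged) (KS.fT mk fx κ Φ t p O.merged) (cOf κ Φ t p O (KS.gT mk gx) (KS.fT mk fx) cv) (hOf κ Φ t p O (KS.gT mk gx) (KS.fT mk fx) hv)).c 1 ≤ 5 * ((fcellsV κ Φ t p O.merged (KS.gT mk gx κ Φ t p O.merged) (KS.fT mk fx κ Φ t p O.merged) (cOf κ Φ t p O (KS.gT mk gx) (KS.fT mk fx) cv) (hOf κ Φ t p O (KS.gT mk gx) (KS.fT mk fx) hv)).r 0 : ℤ))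
    (hkE24 : 2 * (kEY + ((fcellsV κ Φ t p O.merged (KS.gT mk gx κ Φ t p O.merged) (KS.fT mk fx κ Φ t p O.merged) (cOf κ Φ t p O (KS.gT mk gx) (KS.fT mk fx) cv) (hOf κ Φ t p O (KS.gT mk gx) (KS.fT mk fx) hv)).r 0 : ℤ)) + 24 * KS.u₀A κ Φ t p O.merged (KS.gT mk gx κ Φ t p O.merged) (KS.fT mk fx κ Φ t p O.merged) + 24 + 2 * ((fcellsV κ Φ t p O.merged (KS.gT mk gx κ Φ t p O.merged) (KS.fT mk fx κ Φ t p O.merged) (cOf κ Φ t p O (KS.gT mk gx) (KS.fT mk fx) cv) (hOf κ Φ t p O (KS.gT mk gx) (KS.fT mk fx) hv)).c 1 : ℤ) ≤ 5 * ((fcellsV κ Φ t p O.merged (KS.gT mk gx κ Φ t p O.merged) (KS.fT mk fx κ Φ t p O.merged) (cOf κ Φ t p O (KS.gT mk gx) (KS.fT mk fx) cv) (hOf κ Φ t p O (KS.gT mk gx) (KS.fT mk fx) hv)).r 0 : ℤ))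
    (hfwdY : 2 * kEY + ((fcellsV κ Φ t p O.merged (KS.gT mk gx κ Φ t p O.merged) (KS.fT mk fx κ Φ t p O.merged) (cOf κ Φ t p O (KS.gT mk gx) (KS.fT mk fx) cv) (hOf κ Φ t p O (KS.gT mk gx) (KS.fT mk fx) hv)).hF 1 : ℤ) - (fcellsV κ Φ t p O.merged (KS.gT mk gx κ Φ t p O.merged) (KS.fT mk fx κ Φ t p O.merged) (cOf κ Φ t p O (KS.gT mk gx) (KS.fT mk fx) cv) (hOf κ Φ t p O (KS.gT mk gx) (KS.fT mk fx) hv)).hB 1 + 14 * KS.u₀A κ Φ t p O.merged (KS.gT mk gx κ Φ t p O.merged) (KS.fT mk fx κ Φ t p O.merged) ≤ 2 * (((fcellsV κ Φ t p O.merged (KS.gT mk gx κ Φ t p O.merged) (KS.fT mk fx κ Φ t p O.merged) (cOf κ Φ t p O (KS.gT mk gx) (KS.fT mk fx) cv) (hOf κ Φ t p O (KS.gT mk gx) (KS.fT mk fx) hv)).c 1 : ℤ) + (KS.bwY κ Φ t p O.merged (KS.gT mk gx κ Φ t p O.merged) (KS.fT mk fx κ Φ t p O.merged))))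
    (hfwdYx : 2 * kEY + ((fcellsV κ Φ t p O.merged (KS.gT mk gx κ Φ t p O.merged) (KS.fT mk fx κ Φ t p O.merged) (cOf κ Φ t p O (KS.gT mk gx) (KS.fT mk fx) cv) (hOf κ Φ t p O (KS.gT mk gx) (KS.fT mk fx) hv)).hF 1 : ℤ) - (fcellsV κ Φ t p O.merged (KS.gT mk gx κ Φ t p O.merged) (KS.fT mk fx κ Φ t p O.merged) (cOf κ Φ t p O (KS.gT mk gx) (KS.fT mk fx) cv) (hOf κ Φ t p O (KS.gT mk gx) (KS.fT mk fx) hv)).hB 1 + 24 * KS.u₀A κ Φ t p O.merged (KS.gT mk gx κ Φ t p O.merged) (KS.fT mk fx κ Φ t p O.merged) + 10 ≤ 2 * (((fcellsV κ Φ t p O.merged (KS.gT mk gx κ Φ t p O.merged) (KS.fT mk fx κ Φ t p O.merged) (cOf κ Φ t p O (KS.gT mk gx) (KS.fT mk fx) cv) (hOf κ Φ t p O (KS.gT mk gx) (KS.fT mk fx) hv)).c 1 : ℤ) + (KS.bwY κ Φ t p O.merged (KS.gT mk gx κ Φ t p O.merged) (KS.fT mk fx κ Φ t p O.merged))))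
    (hc600 : 600 * Neg.Kq κ ≤ cW)
    (hrX : KS.πBudX κ Φ t p O.merged cW mk (KS.gT mk gx κ Φ t p O.merged) (KS.fT mk fx κ Φ t p O.merged) ≤ r)
    (hrY : KS.πBudY κ Φ t p O.merged cW mk (KS.gT mk gx κ Φ t p O.merged) (KS.fT mk fx κ Φ t p O.merged) ≤ r)
    (hnB840 : 840 * Neg.Kq κ + 10 ≤ nB)
    -- (hp-8 g44) layer (a4)'s own node row: the bridge core's reach under the kit radius (`|core1Lo|₁ ≤ YbF ≤ r`)
    (hYbr : KS.YbF κ Φ t p O.merged cW mk (KS.gT mk gx κ Φ t p O.merged) (KS.fT mk fx κ Φ t p O.merged) ≤ r) :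
    Skelφ.FaceOblRMOF G ((choiceAtQ3V κ Φ t p Pv (KS.gT mk gx) (KS.fT mk fx) (SUS ex mx) cv hv BSlot.small3 hC).scheme O q)
      ((choiceAtQ3V κ Φ t p Pv (KS.gT mk gx) (KS.fT mk fx) (SUS ex mx) cv hv BSlot.small3 hC).FD O q) Φ.Δ κ.δ₂ := by
  have hAt3 := atQ3_of_atQ3V hAt
  have hAtT := atQ3T_of_atQ3 hAt3
  have hNL : EqNumL κ Φ t p O.merged (KS.gT mk gx κ Φ t p O.merged) (KS.fT mk fx κ Φ t p O.merged) := eqNumL_of_atQT hAtT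
  have hκ10 : (hL κ Φ t p O.merged (KS.gT mk gx κ Φ t p O.merged) (KS.fT mk fx κ Φ t p O.merged)).natAbs ≤ 10 * nL κ Φ t p O.merged (KS.gT mk gx κ Φ t p O.merged) (KS.fT mk fx κ Φ t p O.merged) := (clauseL_of_atQT hAtT).2
  obtain ⟨hnL1, hℓL1⟩ := one_le_of_eqNumL κ Φ t p O.merged (KS.gT mk gx κ Φ t p O.merged) (KS.fT mk fx κ Φ t p O.merged) hNL
  obtain ⟨-, -, -, hSF, -, hMLR, -, -⟩ := KS.slotsF_hyps κ Φ t p O.merged cW mk gx fx hgx hfx hNL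
  -- the bridge pair's clause and its consequences
  have hadm := KS.bridgeF_adm κ Φ t p O.merged cW mk
  have hEg := (clauseP_of_atQT hAtT hadm.1 hadm.2).1
  have hℓBF := KS.ℓBF_ge κ Φ t p O.merged cW mk _ hEg
  have hbF := (KS.bF_facts κ Φ t p O.merged cW mk).1
  have hℓ3 : 3 ≤ KS.ℓBF κ Φ t p O.merged cW mk := by omega
  have hℓ27 : 27 ≤ KS.ℓBF κ Φ t p O.merged cW mk := by omega
  have hBv : BridgeOK (KS.BFs κ Φ t p O.merged cW mk (KS.gT mk gx κ Φ t p O.merged) (KS.fT mk fx κ Φ t p O.merged) 1) := (KS.BF_ok κ Φ t p O.merged cW mk (KS.gT mk gx κ Φ t p O.merged) (KS.fT mk fx κ Φ t p O.merged) (Or.inl rfl) hℓ3).1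
  have hπ1v : (((KS.BFs κ Φ t p O.merged cW mk (KS.gT mk gx κ Φ t p O.merged) (KS.fT mk fx κ Φ t p O.merged) 1).core1Lo 0).natAbs + ((KS.BFs κ Φ t p O.merged cW mk (KS.gT mk gx κ Φ t p O.merged) (KS.fT mk fx κ Φ t p O.merged) 1).core1Lo 1).natAbs) ≤ r := le_trans (KS.core1LoF_l1 κ Φ t p O.merged cW mk (KS.gT mk gx κ Φ t p O.merged) (KS.fT mk fx κ Φ t p O.merged) (Or.inl rfl) hℓ27).1 hYbr
  have hclr1v : (((Mu O.merged) : ℕ) : ℤ) < (KS.BFs κ Φ t p O.merged cW mk (KS.gT mk gx κ Φ t p O.merged) (KS.fT mk fx κ Φ t p O.merged) 1).B₀lo 0 - (KS.BFs κ Φ t p O.merged cW mk (KS.gT mk gx κ Φ t p O.merged) (KS.fT mk fx κ Φ t p O.merged) 1).R' - (KS.BFs κ Φ t p O.merged cW mk (KS.gT mk gx κ Φ t p O.merged) (KS.fT mk fx κ Φ t p O.merged) 1).pr := (KS.hclr₁_BF κ Φ t p O.merged cW mk gx (KS.fT mk fx κ Φ t p O.merged) hMLR hSF (σ := 1)).1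
  -- levels of the (S0) kit and the bridge kit's level-width rows
  have hT0pos : 1 ≤ KS0.T0 t O.merged mk := by
    have h := (KS0.kit0_ok t O.merged mk ((((Mu O.merged)) : ℤ) + 2) (KS0.r₀0 t O.merged mk Rb) (kq := 0) (by norm_num)).2.2.2.1; unfold KS0.T0 KS0.M0; omega
  have hwA : ∀ (A : ℤ) (r₀ : ℕ), 2 * ((tanOff (KS0.kit0 t O.merged mk A r₀).ℓs (KS0.kit0 t O.merged mk A r₀).M : ℕ) : ℤ) ≤ 2 * (((KS0.j₀0 t O.merged mk) : ℕ) : ℤ) := fun A r₀ => by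
    rw [KS0.tanOff_kit0]; unfold KS0.j₀0; exact le_rfl
  have hwD : ∀ (A : ℤ) (r₀ : ℕ), (((KS0.kit0 t O.merged mk A r₀).d + 2 : ℕ) : ℤ) ≤ 2 * (((KS0.j₀0 t O.merged mk) : ℕ) : ℤ) := fun A r₀ => by
    have h := (KS0.levels_wide t O.merged mk (le_refl (KS0.j₀0 t O.merged mk))).2.1
    rw [(KS0.kit0_fields t O.merged mk A r₀).2.2.2.1]; unfold KS0.j₀0 at *; push_cast; omega
  have hwDD : ∀ (A : ℤ) (r₀ : ℕ), ((Skelφ.shellD (KS0.kit0 t O.merged mk A r₀) + 1 + (KS0.kit0 t O.merged mk A r₀).d + (KS.KCmax t O.merged mk) + (KS.Rs t O.merged mk) : ℕ) : ℤ) ≤ 2 * (((KS0.j₀0 t O.merged mk) : ℕ) : ℤ) := fun A r₀ => by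
    have h := (KS0.levels_wide t O.merged mk (le_refl (KS0.j₀0 t O.merged mk))).2.2
    rw [KS0.shellD_kit0, (KS0.kit0_fields t O.merged mk A r₀).2.2.2.1]; unfold KS0.j₀0 at *; push_cast; omega
  have hB0le : (KS.BFs κ Φ t p O.merged cW mk (KS.gT mk gx κ Φ t p O.merged) (KS.fT mk fx κ Φ t p O.merged) 1).B₀lo ≤ (KS.BFs κ Φ t p O.merged cW mk (KS.gT mk gx κ Φ t p O.merged) (KS.fT mk fx κ Φ t p O.merged) 1).B₀hi := by
    rw [(KS.BF_shared κ Φ t p O.merged cW mk (KS.gT mk gx κ Φ t p O.merged) (KS.fT mk fx κ Φ t p O.merged) 1).1.1, (KS.BF_shared κ Φ t p O.merged cW mk (KS.gT mk gx κ Φ t p O.merged) (KS.fT mk fx κ Φ t p O.merged) 1).2.1.1]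
    intro i; unfold Skelφ.pt; split_ifs <;> push_cast <;> omega
  have hreach0 : ∀ (A : ℤ) (r₀ : ℕ), (KS0.j₁0 κ Φ t p O.merged mk) +
      ((KS0.kit0 t O.merged mk A r₀).N * (tanOff (KS0.kit0 t O.merged mk A r₀).ℓs (KS0.kit0 t O.merged mk A r₀).M + 1) +
        (KS0.kit0 t O.merged mk A r₀).N * (KS0.kit0 t O.merged mk A r₀).d + KS.KCmax t O.merged mk) ≤ (KS0.R'0 κ Φ t p O.merged mk) := by
    intro A r₀
    rw [KS0.tanOff_kit0]
    simp only [KS0.kit0]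
    have h := (KS0.R'0_eq κ Φ t p O.merged mk).1
    unfold KS0.reach0 at h
    omega
  have hEbv : (KS0.j₁0 κ Φ t p O.merged mk) + ((KS0.kit0 t O.merged mk ((((Mu O.merged)) : ℤ) + 2) (KS0.r₀0 t O.merged mk Rb)).N * (tanOff (KS0.kit0 t O.merged mk ((((Mu O.merged)) : ℤ) + 2) (KS0.r₀0 t O.merged mk Rb)).ℓs (KS0.kit0 t O.merged mk ((((Mu O.merged)) : ℤ) + 2) (KS0.r₀0 t O.merged mk Rb)).M + 1) +
      (KS0.kit0 t O.merged mk ((((Mu O.merged)) : ℤ) + 2) (KS0.r₀0 t O.merged mk Rb)).N * (KS0.kit0 t O.merged mk ((((Mu O.merged)) : ℤ) + 2) (KS0.r₀0 t O.merged mk Rb)).d + KS.KCmax t O.merged mk) ≤ (KS.BFs κ Φ t p O.merged cW mk (KS.gT mk gx κ Φ t p O.merged) (KS.fT mk fx κ Φ t p O.merged) 1).R' := by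
    have h1 := hreach0 ((((Mu O.merged)) : ℤ) + 2) (KS0.r₀0 t O.merged mk Rb)
    have h2 := (KS.BF_R'_ge κ Φ t p O.merged cW mk (KS.gT mk gx κ Φ t p O.merged) (KS.fT mk fx κ Φ t p O.merged) 1).1
    have h3 := (KS0.R'0_eq κ Φ t p O.merged mk).2.1
    omega
  -- the long numbers' layer inequality and the zone clearance
  have hMuR : (Mu O.merged) < (KS0.R'0 κ Φ t p O.merged mk) := by
    have hKC := (KS0.kit0_ok t O.merged mk ((((Mu O.merged)) : ℤ) + 2) (KS0.r₀0 t O.merged mk Rb) (kq := 0) (by norm_num)).2.2.2.1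
    have hReach : KS0.reach0 t O.merged mk < (KS0.R'0 κ Φ t p O.merged mk) := (KS0.T0_lt_R'0 κ Φ t p O.merged mk).2.2.1
    unfold KS0.reach0 at hReach; omega
  have hlayv : ((nL κ Φ t p O.merged (KS.gT mk gx κ Φ t p O.merged) (KS.fT mk fx κ Φ t p O.merged)) + (prFA κ Φ t p O.merged (KS.gT mk gx κ Φ t p O.merged) (KS.fT mk fx κ Φ t p O.merged)).h.natAbs : ℕ) ≤ ((nL κ Φ t p O.merged (KS.gT mk gx κ Φ t p O.merged) (KS.fT mk fx κ Φ t p O.merged)) : ℤ) * (ℓL κ Φ t p O.merged (KS.gT mk gx κ Φ t p O.merged) (KS.fT mk fx κ Φ t p O.merged)) + 1 := by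
    have h1 : |(prFA κ Φ t p O.merged (KS.gT mk gx κ Φ t p O.merged) (KS.fT mk fx κ Φ t p O.merged)).h| ≤ 10 * ((nL κ Φ t p O.merged (KS.gT mk gx κ Φ t p O.merged) (KS.fT mk fx κ Φ t p O.merged)) : ℤ) := by
      have h := hκ10; have e : (prFA κ Φ t p O.merged (KS.gT mk gx κ Φ t p O.merged) (KS.fT mk fx κ Φ t p O.merged)).h = hL κ Φ t p O.merged (KS.gT mk gx κ Φ t p O.merged) (KS.fT mk fx κ Φ t p O.merged) := rfl
      rw [e, ← Int.natCast_natAbs]; exact_mod_cast h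
    have h2 : (11 : ℤ) ≤ ((ℓL κ Φ t p O.merged (KS.gT mk gx κ Φ t p O.merged) (KS.fT mk fx κ Φ t p O.merged)) : ℤ) := by have := hNL.ℓ_le; have := hMLR; push_cast at *; omega
    have h0 : (0 : ℤ) ≤ ((nL κ Φ t p O.merged (KS.gT mk gx κ Φ t p O.merged) (KS.fT mk fx κ Φ t p O.merged)) : ℤ) := by positivity
    simp only [Nat.cast_add, Int.natCast_natAbs]
    nlinarith [h1, mul_le_mul_of_nonneg_left h2 h0]
  have hclrzv : ((Mu O.merged) + 4) * ((nL κ Φ t p O.merged (KS.gT mk gx κ Φ t p O.merged) (KS.fT mk fx κ Φ t p O.merged)) + (prFA κ Φ t p O.merged (KS.gT mk gx κ Φ t p O.merged) (KS.fT mk fx κ Φ t p O.merged)).h.natAbs) ≤ (nL κ Φ t p O.merged (KS.gT mk gx κ Φ t p O.merged) (KS.fT mk fx κ Φ t p O.merged)) * ((ℓL κ Φ t p O.merged (KS.gT mk gx κ Φ t p O.merged) (KS.fT mk fx κ Φ t p O.merged)) + 1) := by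
    have hlayer := hNL.layer
    have hM3 : (((Mu O.merged) : ℕ) : ℤ) + 4 ≤ (ML κ Φ t p O.merged (KS.gT mk gx κ Φ t p O.merged) : ℤ) + 1 := by have := hMLR; push_cast at *; omega
    have hx : (0 : ℤ) ≤ ((nL κ Φ t p O.merged (KS.gT mk gx κ Φ t p O.merged) (KS.fT mk fx κ Φ t p O.merged)) : ℤ) + |hL κ Φ t p O.merged (KS.gT mk gx κ Φ t p O.merged) (KS.fT mk fx κ Φ t p O.merged)| := by positivity
    have h : ((((Mu O.merged) : ℕ) : ℤ) + 4) * (((nL κ Φ t p O.merged (KS.gT mk gx κ Φ t p O.merged) (KS.fT mk fx κ Φ t p O.merged)) : ℤ) + |hL κ Φ t p O.merged (KS.gT mk gx κ Φ t p O.merged) (KS.fT mk fx κ Φ t p O.merged)|) ≤ ((nL κ Φ t p O.merged (KS.gT mk gx κ Φ t p O.merged) (KS.fT mk fx κ Φ t p O.merged)) : ℤ) * (((ℓL κ Φ t p O.merged (KS.gT mk gx κ Φ t p O.merged) (KS.fT mk fx κ Φ t p O.merged)) : ℤ) + 1) := le_trans (mul_le_mul_of_nonneg_right hM3 hx) hl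ayer
    have key : ∀ (Mu n ℓ : ℕ) (hh : ℤ), ((Mu : ℤ) + 4) * ((n : ℤ) + |hh|) ≤ (n : ℤ) * ((ℓ : ℤ) + 1) → (Mu + 4) * (n + hh.natAbs) ≤ n * (ℓ + 1) :=
      fun Mu n ℓ hh hle => by
        have h' : (((Mu + 4) * (n + hh.natAbs) : ℕ) : ℤ) ≤ ((n * (ℓ + 1) : ℕ) : ℤ) := by push_cast [Int.natCast_natAbs]; linarith
        exact_mod_cast h'
    exact key _ _ _ _ h
  -- the F-Λ zone bound from `M_u ≤ e_F`
  have hMe : (((Mu O.merged) : ℕ) : ℤ) ≤ ((KS.eF κ Φ t p O.merged cW mk : ℕ) : ℤ) := by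
    have : (Mu O.merged) ≤ KS.eF κ Φ t p O.merged cW mk := by unfold KS.eF; omega
    exact_mod_cast this
  have hmod0 : 0 < modulus (nL κ Φ t p O.merged (KS.gT mk gx κ Φ t p O.merged) (KS.fT mk fx κ Φ t p O.merged)) (hL κ Φ t p O.merged (KS.gT mk gx κ Φ t p O.merged) (KS.fT mk fx κ Φ t p O.merged)) (vL κ Φ t p O.merged (KS.gT mk gx κ Φ t p O.merged) (KS.fT mk fx κ Φ t p O.merged)) (vβL κ Φ t p O.merged (KS.gT mk gx κ Φ t p O.merged) (KS.fT mk fx κ Φ t p O.merged)) := Skelφ.NegPrm.modulus_vβOf_pos hnL1 hℓL1 _ _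
  have hΛZv : (|(prFA κ Φ t p O.merged (KS.gT mk gx κ Φ t p O.merged) (KS.fT mk fx κ Φ t p O.merged)).vβ| + |(prFA κ Φ t p O.merged (KS.gT mk gx κ Φ t p O.merged) (KS.fT mk fx κ Φ t p O.merged)).vα|) * (((Mu O.merged) : ℕ) : ℤ) ≤ (KS.ΛF₀ κ Φ t p O.merged cW mk (KS.gT mk gx κ Φ t p O.merged) (KS.fT mk fx κ Φ t p O.merged)) ∧ (((nL κ Φ t p O.merged (KS.gT mk gx κ Φ t p O.merged) (KS.fT mk fx κ Φ t p O.merged)) : ℤ) + |(prFA κ Φ t p O.merged (KS.gT mk gx κ Φ t p O.merged) (KS.fT mk fx κ Φ t p O.merged)).h|) * (((Mu O.merged) : ℕ) : ℤ) ≤ (KS.ΛF₁ κ Φ t p O.merged cW mk (KS.gT mk gx κ Φ t p O.merged) (KS.fT mk fx κ Φ t p O.merged)) := by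
    have e1 : (prFA κ Φ t p O.merged (KS.gT mk gx κ Φ t p O.merged) (KS.fT mk fx κ Φ t p O.merged)).vβ = vβL κ Φ t p O.merged (KS.gT mk gx κ Φ t p O.merged) (KS.fT mk fx κ Φ t p O.merged) := rfl
    have e2 : (prFA κ Φ t p O.merged (KS.gT mk gx κ Φ t p O.merged) (KS.fT mk fx κ Φ t p O.merged)).vα = vL κ Φ t p O.merged (KS.gT mk gx κ Φ t p O.merged) (KS.fT mk fx κ Φ t p O.merged) := rfl
    have e3 : (prFA κ Φ t p O.merged (KS.gT mk gx κ Φ t p O.merged) (KS.fT mk fx κ Φ t p O.merged)).h = hL κ Φ t p O.merged (KS.gT mk gx κ Φ t p O.merged) (KS.fT mk fx κ Φ t p O.merged) := rfl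
    rw [e1, e2, e3]
    have hb := abs_nonneg (vβL κ Φ t p O.merged (KS.gT mk gx κ Φ t p O.merged) (KS.fT mk fx κ Φ t p O.merged)); have ha := abs_nonneg (vL κ Φ t p O.merged (KS.gT mk gx κ Φ t p O.merged) (KS.fT mk fx κ Φ t p O.merged)); have hh := abs_nonneg (hL κ Φ t p O.merged (KS.gT mk gx κ Φ t p O.merged) (KS.fT mk fx κ Φ t p O.merged))
    have hn : (0 : ℤ) ≤ ((nL κ Φ t p O.merged (KS.gT mk gx κ Φ t p O.merged) (KS.fT mk fx κ Φ t p O.merged)) : ℤ) := by positivity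
    have hl : (0 : ℤ) ≤ ((ℓL κ Φ t p O.merged (KS.gT mk gx κ Φ t p O.merged) (KS.fT mk fx κ Φ t p O.merged)) : ℤ) := by positivity
    have he : (0 : ℤ) ≤ ((KS.eF κ Φ t p O.merged cW mk : ℕ) : ℤ) := by positivity
    constructor
    · unfold KS.ΛF₀
      nlinarith [mul_le_mul_of_nonneg_left hMe hb, mul_le_mul_of_nonneg_left hMe ha, hmod0.le, mul_nonneg hn hl, mul_nonneg ha hl]
    · unfold KS.ΛF₁
      nlinarith [mul_le_mul_of_nonneg_left hMe (add_nonneg hn hh), mul_nonneg hn hl]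
  exact faceOblRM_frmBVC₃ (Λ₀ := (KS.ΛF₀ κ Φ t p O.merged cW mk (KS.gT mk gx κ Φ t p O.merged) (KS.fT mk fx κ Φ t p O.merged))) (Λ₁ := (KS.ΛF₁ κ Φ t p O.merged cW mk (KS.gT mk gx κ Φ t p O.merged) (KS.fT mk fx κ Φ t p O.merged))) (kb := (Mu O.merged)) mk cW gx fx hgx hfx ex mx hmx hAt h1 hp0 hp1 hMR0 hL' Φ.degree_le (KS.prFA_pos κ Φ t p O.merged (KS.gT mk gx κ Φ t p O.merged) (KS.fT mk fx κ Φ t p O.merged) hNL).1 hnL1 hNL.v_le (KS.prFA_pos κ Φ t p O.merged (KS.gT mk gx κ Φ t p O.merged) (KS.fT mk fx κ Φ t p O.merged) hNL).2.2.1.le hBv hlayv (KS.BF_R'_ge κ Φ t p O.merged cW mk (KS.gT mk gx κ Φ t p O.merged) (KS.fT mk fx κ Φ t p O.merged) 1).1 (KS.hB0_F κ Φ t p O.merged cW mk (KS.gT mk gx κ Φ t p O.merged) (KS.fT mk fx κ Φ t p O.merged) 1).1 hRlr (KS.hΛR_F κ Φ t p O.merged cW mk (KS.gT mk gx κ Φ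 t p O.merged) (KS.fT mk fx κ Φ t p O.merged) hNL (Or.inl rfl)) (KS.hΛQ_F κ Φ t p O.merged cW mk (KS.gT mk gx κ Φ t p O.merged) (KS.fT mk fx κ Φ t p O.merged)).1 (KS.hΛQ_F κ Φ t p O.merged cW mk (KS.gT mk gx κ Φ t p O.merged) (KS.fT mk fx κ Φ t p O.merged)).2 hΛZv (KS.hkF0_RA κ Φ t p O.merged cW mk (KS.gT mk gx κ Φ t p O.merged) (KS.fT mk fx κ Φ t p O.merged) hNL) (KS.hkF1_RA κ Φ t p O.merged cW mk (KS.gT mk gx κ Φ t p O.merged) (KS.fT mk fx κ Φ t p O.merged) hNL) le_rfl hπ1v hclr1v nB hchain (fun j hj _ i => Skelφ.icc_level_room hB0le hj (hwA _ _) i) (fun j hj _ i => Skelφ.icc_level_room hB0le hj (hwD _ _) i) (fun j hj _ i => Skelφ.icc_level_room hB0le hj (hwDD _ _) i) hRb₀ hEbv hr₁R hRr₀ hr₂R hclrzv hRsr hρr Qb Fb hQb hFb hbridge hR₁b hR₁r hr₀L hroomX hroomY hZk hkEr hkE2 hfwdX hkE hkE8 hkE24 hfwdY hfwdYx hc600 hrX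 hrY hnB840

end NegB

end PlanarSkeletonFrm

end Summit.CriticalPhenomena.PercolationContinuityZ3.Theorems.Transplant

end


/-!
# N2 (frames-only node, OPEN) — (F) column, THE WRAPPER's LAYER (a5): `NegB.faceOblRM_frmBVC₅` = layer (a4) `faceOblRM_frmBVC₄` WITH THE BRIDGE INPUTS AND
# THE INNER-CHAIN FACT DISCHARGED (hp-8 g44; generated by bin/gen_btc5v.py)
The bridge kit reads the ONE face bridge frame `KS.BFs … 1` (same orientation, served sign `1`; (R-41)(b)/(R-44)(c)): `Qb c := pgramPrismFin G φL c nBF hBF (3ℓBF) Rb`,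
`Fb c := pgSideHalfW G φL c nBF hBF ℓBF Rb 1 1`, `Rb := O.merged.R (O.merged.scale t MBF nBF)`; the readings `hQb/hFb` are `Skelφ.bridgeSets_same` (zone at the seed
level `k` inside `cyl φL c k` — p3-g17's `zoneK_subset_cyl_φL` —, `k < nBF` by `bF_facts/RF2F`); THE BRIDGE EVENT `hbridge` at accuracy `1 − δkit³` is stmt's
`inputsPAt_cube_of_atQT` at the bridge pair `(MBF, nBF) ∈ Pv` (binder `hPx`; `SMnP = SMn ∪ Pv`) — the pair is a SELECTED pair (`MB/nB` read `sM/sN`), so its served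
quadrant is `(E, N)` (`sgQ_sel_eq_oneT`) and its orientation is the long pair's (`FactsNS.sel_ori`, hence `oriφ Φ.φ (O.ori t MBF nBF) = φL`); `hchain` is
`hchain_of_chainFactQT Lf κ hCF (q < 1) (δkit ≤ δr 0) (nB ≤ Lf K₀) r` (binders `Lf`, `hCF : ChainFactQT Lf G Φ.Δ κ (κ.δ₂³)`, `hnBL` — the wrapper's
`…_of_residue` supplies them as in N1).  KEPT for the slot layer / the wrapper: the slot-floor rows on `r`/`L′`/`ex`, layer (a2)'s rows, `nB/hnB840/hnBL`,
`hgx/hfx/hmx/hMR0/hPx/h1/hp0/hp1/hYbr`.  Conclusion BY NAME as (a0)–(a4).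
builds on p205010 (kernel theorem, internal audit signed; external expert review pending) — nothing here uses p205010; NOTHING is claimed about the open node
`SamePDropOfSkeletonFrm₁`.
Lane `prim-bschramm`, seat `prim-hp-8` (gen 44); helper file (`--supports stmt-CriticalPhenomena-4575 --as helper`).
[cite: KozmaNitzan2024, §4 Lemma 10 Step IV (pp. 20–21), Lemma 11 (pp. 22–23), Lemma 12 (pp. 23–25)] [cite: MartineauTassion2017, §3.2 Lemma 3.5, §4.3 Lemma 4.2]
-/

noncomputable section

open scoped Classical ENNReal

namespace Summit.CriticalPhenomena.PercolationContinuityZ3.Theorems.Transplant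

namespace PlanarSkeletonFrm

namespace NegB

open MeasureTheory Literature.Probability.Percolation Literature.Probability.LatticeModels SimpleGraph KNCells KNLevels GadgetSystem Contour
open Literature.Probability.Percolation.KozmaNitzan
open Literature.Probability.Percolation.KozmaNitzan.Cells (oth sgOf sgOf_sign stepVec_apply_fst)
open Literature.Barriers.CriticalPhenomena (graphBall mem_graphBall_self graphBall_mono)
open BoxProdZ2 (ConcRadiiG Erad Frad nQ nS)
open ChainPlanar ChainPara
open Skel (winGraph routeW excess WinStepData)
open SkelI (tanOff)
open TwoAxis.Para (modulus detD rep₂)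
open SkelConc (Consts)
open Skelφ
open Skelφ.StepI (DataNS OutNS)
open Neg

variable {κ : Consts} {V : Type} [DecidableEq V] [Countable V] {G : SimpleGraph V} [G.LocallyFinite] {Φ : PlanarSkeletonFrm G} {t : V}
  {p : unitInterval} {Pv : NegB.PSlot} {cv hv : NegB.CSlot} {hC : Φ.CylSubcritical p}
  {O : OutNS V} {q : unitInterval}

set_option maxHeartbeats 3200000 in
/-- **Layer (a5) of the (F) wrapper at the Q3V tuple: the bridge inputs and the inner-chain fact discharged** (see the module docstring).
[cite: KozmaNitzan2024, §4 Lemma 10 Step IV (pp. 20–21), Lemma 12 (pp. 23–25)] -/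
theorem faceOblRM_frmBVC₅
    (mk cW : ℕ)
    (gx fx : Neg.FSlot)
    (hgx : ∀ D : DataNS V, gxFc mk cW κ Φ t p D ≤ gx κ Φ t p D)
    (hfx : ∀ D : DataNS V, fxFc mk κ Φ t p D ≤ fx κ Φ t p D)
    (ex mx : GSlot)
    (hmx : (prFA κ Φ t p O.merged (KS.gT mk gx κ Φ t p O.merged) (KS.fT mk fx κ Φ t p O.merged)).mF (fcellsA κ Φ t p O.merged (KS.gT mk gx κ Φ t p O.merged) (KS.fT mk fx κ Φ t p O.merged)) ≤ (((mx κ Φ t p O.merged (KS.gT mk gx κ Φ t p O.merged) (KS.fT mk fx κ Φ t p O.merged)) : ℕ) : ℤ))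
    (hAt : (choiceAtQ3V κ Φ t p Pv (KS.gT mk gx) (KS.fT mk fx) (SUS ex mx) cv hv BSlot.small3 hC).AtQNQ O q)
    (h1 : Φ.types = {t})
    (hp0 : 0 < (p : ℝ))
    (hp1 : (p : ℝ) < 1)
    (hMR0 : 4 * Neg.K κ * (KS0.R'0 κ Φ t p O.merged mk + 2) ≤ ML κ Φ t p O.merged (KS.gT mk gx κ Φ t p O.merged))
    (hPx : ((KS.MBF κ Φ t p O.merged cW mk), (KS.nBF κ Φ t p O.merged cW mk)) ∈ (Pv κ Φ t p O.merged).1)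
    (Lf : ℕ → ℕ) (hCF : ChainFactQT Lf G Φ.Δ κ (κ.δ₂ ^ 3))
    -- the binders of `faceOblRM_fineNb2V` (schemeO side)
    (hL' : 1 ≤ (Skelφ.Prm.Lp ((SUS ex mx) κ Φ t p O.merged (KS.gT mk gx κ Φ t p O.merged) (KS.fT mk fx κ Φ t p O.merged) q)))
    -- the binders of the keystone `hkits_faceSteps_of_nums6` (kit / route / Λ / numbers)
    {r : ℕ}
    -- THE ROUTE BLOCK (c-uniform; all signs)
    (hRlr : (RL κ Φ t p O (KS.gT mk gx) (KS.fT mk fx)) ≤ r)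
    -- the near-`c` block READ BY THE TWO LATTICE FUNCTIONALS (L-F2): bridge regions (every frame sign), hop prism, zone box, fine extents `kA`
    (nB : ℕ)
    -- the inner-chain fact UP TO THE LENGTH BUDGET `nF` (p3-g11 2026-08-22T02:23:54Z; the wrapper discharges it by `ChainFactF` at `n ≤ LfA K₀`)
    (hRb₀ : (KS0.kit0 t O.merged mk ((((Mu O.merged)) : ℤ) + 2) (KS0.r₀0 t O.merged mk (O.merged.R (O.merged.scale t (KS.MBF κ Φ t p O.merged cW mk) (KS.nBF κ Φ t p O.merged cW mk))))).r₀ ≤ r)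
    (hr₁R : (O.merged.R (O.merged.scale t (KS.MBF κ Φ t p O.merged cW mk) (KS.nBF κ Φ t p O.merged cW mk))) ≤ r)
    (hRr₀ : (KS0.kit0 t O.merged mk (((((Mu O.merged)) + 1 : ℕ) : ℤ) * ((shearUnit (nL κ Φ t p O.merged (KS.gT mk gx κ Φ t p O.merged) (KS.fT mk fx κ Φ t p O.merged)) (prFA κ Φ t p O.merged (KS.gT mk gx κ Φ t p O.merged) (KS.fT mk fx κ Φ t p O.merged)).h) : ℤ) + 1) (KS0.r₀0 t O.merged mk (RL κ Φ t p O (KS.gT mk gx) (KS.fT mk fx)))).r₀ ≤ r)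
    (hr₂R : (RL κ Φ t p O (KS.gT mk gx) (KS.fT mk fx)) ≤ r)
    -- the short region and the zone datum at the kit centres ((S0): inside `Rg`, connected, containing the centre and the fat-prism box `cylBallFin c kz Rk`)
    (hRsr : (KS.Rs t O.merged mk) ≤ r)
    (hρr : (Skelφ.fatRadius Φ.frame hC O.merged.k) ≤ r)
    (hR₁b : ((SUS ex mx κ Φ t p O.merged (KS.gT mk gx κ Φ t p O.merged) (KS.fT mk fx κ Φ t p O.merged) q).Rex (Skelφ.fatRadius Φ.frame hC O.merged.k)) ≤ r - (KS0.kit0 t O.merged mk ((((Mu O.merged)) : ℤ) + 2) (KS0.r₀0 t O.merged mk (O.merged.R (O.merged.scale t (KS.MBF κ Φ t p O.merged cW mk) (KS.nBF κ Φ t p O.merged cW mk))))).r₀)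
    (hR₁r : ((SUS ex mx κ Φ t p O.merged (KS.gT mk gx κ Φ t p O.merged) (KS.fT mk fx κ Φ t p O.merged) q).Rex (Skelφ.fatRadius Φ.frame hC O.merged.k)) ≤ r - (KS0.kit0 t O.merged mk (((((Mu O.merged)) + 1 : ℕ) : ℤ) * ((shearUnit (nL κ Φ t p O.merged (KS.gT mk gx κ Φ t p O.merged) (KS.fT mk fx κ Φ t p O.merged)) (prFA κ Φ t p O.merged (KS.gT mk gx κ Φ t p O.merged) (KS.fT mk fx κ Φ t p O.merged)).h) : ℤ) + 1) (KS0.r₀0 t O.merged mk (RL κ Φ t p O (KS.gT mk gx) (KS.fT mk fx)))).r₀)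
    -- the FACE KIT: constants, exit table rooms, reach, inputs at accuracy `κ.δ₂`
    (hr₀L : (KS0.kit0 t O.merged mk (((((Mu O.merged)) + 1 : ℕ) : ℤ) * (prFA κ Φ t p O.merged (KS.gT mk gx κ Φ t p O.merged) (KS.fT mk fx κ Φ t p O.merged)).D + 1) (KS0.r₀0 t O.merged mk r)).r₀ + 1 ≤ 2 * (Skelφ.Prm.Lp ((SUS ex mx) κ Φ t p O.merged (KS.gT mk gx κ Φ t p O.merged) (KS.fT mk fx κ Φ t p O.merged) q)))
    -- THE PER-CENTRE NUMBERS (x-faces `du.1 = 0`, y′-faces `du.1 = 1`)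
    -- the providers' stride counts within the budget
    -- ONE-SIDED ((R-44)(c)): the numbers' tangential sign is the served sign `1` (one-sided counts `KS.N3WX/N3WY`)
    -- (hp-8 g44) THE NUMBERS BATCH's OWN NODE ROWS: frame rooms at the contact offsets `kEX/kEY` (band `E := Rlev0 + reach0`), the zone bound read by
    -- the two lattice functionals, the one-sided glue rows (x / y′ with `v_L ≥ 0` / y′ with `v_L < 0`), the capacity, the reach budgets, the stride budget
    {kEX kEY : ℤ}
    (hroomX : ∀ du : MDir, du.1 = 0 →
      (prFA κ Φ t p O.merged (KS.gT mk gx κ Φ t p O.merged) (KS.fT mk fx κ Φ t p O.merged)).Mabs * ((fun du : MDir => (((prFA κ Φ t p O.merged (KS.gT mk gx κ Φ t p O.merged) (KS.fT mk fx κ Φ t p O.merged)).awF₂V (fcellsV κ Φ t p O.merged (KS.gT mk gx κ Φ t p O.merged) (KS.fT mk fx κ Φ t p O.merged) (cOf κ Φ t p O (KS.gT mk gx) (KS.fT mk fx) cv) (hOf κ Φ t p O (KS.gT mk gx) (KS.fT mk fx) hv)) du).toNat)) du + (KS0.Rlev0 κ Φ t p O.merged mk + KS0.reach0 t O.merged mk))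 + (prFA κ Φ t p O.merged (KS.gT mk gx κ Φ t p O.merged) (KS.fT mk fx κ Φ t p O.merged)).rdN du.1 ((prFA κ Φ t p O.merged (KS.gT mk gx κ Φ t p O.merged) (KS.fT mk fx κ Φ t p O.merged)).bOf du.1) * ((KS0.Rlev0 κ Φ t p O.merged mk + KS0.reach0 t O.merged mk) + 1) * (prFA κ Φ t p O.merged (KS.gT mk gx κ Φ t p O.merged) (KS.fT mk fx κ Φ t p O.merged)).D ≤ (prFA κ Φ t p O.merged (KS.gT mk gx κ Φ t p O.merged) (KS.fT mk fx κ Φ t p O.merged)).rdK du.1 ((prFA κ Φ t p O.merged (KS.gT mk gx κ Φ t p O.merged) (KS.fT mk fx κ Φ t p O.merged)).bOf du.1) * kEX * (prFA κ Φ t p O.merged (KS.gT mk gx κ Φ t p O.merged) (KS.fT mk fx κ Φ t p O.merged)).D)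
    (hroomY : ∀ du : MDir, du.1 = 1 →
      (prFA κ Φ t p O.merged (KS.gT mk gx κ Φ t p O.merged) (KS.fT mk fx κ Φ t p O.merged)).Mabs * ((fun du : MDir => (((prFA κ Φ t p O.merged (KS.gT mk gx κ Φ t p O.merged) (KS.fT mk fx κ Φ t p O.merged)).awF₂V (fcellsV κ Φ t p O.merged (KS.gT mk gx κ Φ t p O.merged) (KS.fT mk fx κ Φ t p O.merged) (cOf κ Φ t p O (KS.gT mk gx) (KS.fT mk fx) cv) (hOf κ Φ t p O (KS.gT mk gx) (KS.fT mk fx) hv)) du).toNat)) du + (KS0.Rlev0 κ Φ t p O.merged mk + KS0.reach0 t O.merged mk)) + (prFA κ Φ t p O.merged (KS.gT mk gx κ Φ t p O.merged) (KS.fT mk fx κ Φ t p O.merged)).rdN du.1 ((prFA κ Φ t p O.merged (KS.gT mk gx κ Φ t p O.merged) (KS.fT mk fx κ Φ t p O.merged)).bOf du.1) * ((KS0.Rlev0 κ Φ t p O.merged mk + KS0.reach0 t O.merged mk) + 1) * (prFA κ Φ t p O.merged (KS.gT mk gx κ Φ t p O.merged) (KS.fT mk fx κ Φ t p O.merged)).D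 ≤ (prFA κ Φ t p O.merged (KS.gT mk gx κ Φ t p O.merged) (KS.fT mk fx κ Φ t p O.merged)).rdK du.1 ((prFA κ Φ t p O.merged (KS.gT mk gx κ Φ t p O.merged) (KS.fT mk fx κ Φ t p O.merged)).bOf du.1) * kEY * (prFA κ Φ t p O.merged (KS.gT mk gx κ Φ t p O.merged) (KS.fT mk fx κ Φ t p O.merged)).D)
    (hZk : ∀ (c' : V) (du : MDir), ∀ v ∈ O.merged.Λ c' (Mu O.merged), |(prFA κ Φ t p O.merged (KS.gT mk gx κ Φ t p O.merged) (KS.fT mk fx κ Φ t p O.merged)).ψ (φL κ Φ t p O.D O.DT.toDataN O.ori (KS.gT mk gx κ Φ t p O.merged) (KS.fT mk fx κ Φ t p O.merged)) c' v du.1| ≤ (fun i : Fin 2 => if i = 0 then KS.kF₀A κ Φ t p O.merged cW mk (KS.gT mk gx κ Φ t p O.merged) (KS.fT mk fx κ Φ t p O.merged) else KS.kF₁A κ Φ t p O.merged cW mk (KS.gT mk gx κ Φ t p O.merged) (KS.fT mk fx κ Φ t p O.merged)) du.1)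
    (hkEr : kEX + ((fcellsV κ Φ t p O.merged (KS.gT mk gx κ Φ t p O.merged) (KS.fT mk fx κ Φ t p O.merged) (cOf κ Φ t p O (KS.gT mk gx) (KS.fT mk fx) cv) (hOf κ Φ t p O (KS.gT mk gx) (KS.fT mk fx) hv)).r 1 : ℤ) ≤ 5 * ((fcellsV κ Φ t p O.merged (KS.gT mk gx κ Φ t p O.merged) (KS.fT mk fx κ Φ t p O.merged) (cOf κ Φ t p O (KS.gT mk gx) (KS.fT mk fx) cv) (hOf κ Φ t p O (KS.gT mk gx) (KS.fT mk fx) hv)).r 1 : ℤ))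
    (hkE2 : 2 * (kEX + ((fcellsV κ Φ t p O.merged (KS.gT mk gx κ Φ t p O.merged) (KS.fT mk fx κ Φ t p O.merged) (cOf κ Φ t p O (KS.gT mk gx) (KS.fT mk fx) cv) (hOf κ Φ t p O (KS.gT mk gx) (KS.fT mk fx) hv)).r 1 : ℤ)) + 8 * KS.u₁A κ Φ t p O.merged (KS.gT mk gx κ Φ t p O.merged) (KS.fT mk fx κ Φ t p O.merged) + 8 + 2 * ((fcellsV κ Φ t p O.merged (KS.gT mk gx κ Φ t p O.merged) (KS.fT mk fx κ Φ t p O.merged) (cOf κ Φ t p O (KS.gT mk gx) (KS.fT mk fx) cv) (hOf κ Φ t p O (KS.gT mk gx) (KS.fT mk fx) hv)).c 0 : ℤ) ≤ 5 * ((fcellsV κ Φ t p O.merged (KS.gT mk gx κ Φ t p O.merged) (KS.fT mk fx κ Φ t p O.merged) (cOf κ Φ t p O (KS.gT mk gx) (KS.fT mk fx) cv) (hOf κ Φ t p O (KS.gT mk gx) (KS.fT mk fx) hv)).r 1 : ℤ))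
    (hfwdX : 2 * kEX + ((fcellsV κ Φ t p O.merged (KS.gT mk gx κ Φ t p O.merged) (KS.fT mk fx κ Φ t p O.merged) (cOf κ Φ t p O (KS.gT mk gx) (KS.fT mk fx) cv) (hOf κ Φ t p O (KS.gT mk gx) (KS.fT mk fx) hv)).hF 0 : ℤ) - (fcellsV κ Φ t p O.merged (KS.gT mk gx κ Φ t p O.merged) (KS.fT mk fx κ Φ t p O.merged) (cOf κ Φ t p O (KS.gT mk gx) (KS.fT mk fx) cv) (hOf κ Φ t p O (KS.gT mk gx) (KS.fT mk fx) hv)).hB 0 + 6 * KS.u₁A κ Φ t p O.merged (KS.gT mk gx κ Φ t p O.merged) (KS.fT mk fx κ Φ t p O.merged) ≤ 2 * (((fcellsV κ Φ t p O.merged (KS.gT mk gx κ Φ t p O.merged) (KS.fT mk fx κ Φ t p O.merged) (cOf κ Φ t p O (KS.gT mk gx) (KS.fT mk fx) cv) (hOf κ Φ t p O (KS.gT mk gx) (KS.fT mk fx) hv)).c 0 : ℤ) + (KS.bwX κ Φ t p O.merged (KS.gT mk gx κ Φ t p O.merged) (KS.fT mk fx κ Φ t p O.merged))))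
    (hkE : kEY + ((fcellsV κ Φ t p O.merged (KS.gT mk gx κ Φ t p O.merged) (KS.fT mk fx κ Φ t p O.merged) (cOf κ Φ t p O (KS.gT mk gx) (KS.fT mk fx) cv) (hOf κ Φ t p O (KS.gT mk gx) (KS.fT mk fx) hv)).r 0 : ℤ) ≤ 5 * ((fcellsV κ Φ t p O.merged (KS.gT mk gx κ Φ t p O.merged) (KS.fT mk fx κ Φ t p O.merged) (cOf κ Φ t p O (KS.gT mk gx) (KS.fT mk fx) cv) (hOf κ Φ t p O (KS.gT mk gx) (KS.fT mk fx) hv)).r 0 : ℤ))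
    (hkE8 : kEY + ((fcellsV κ Φ t p O.merged (KS.gT mk gx κ Φ t p O.merged) (KS.fT mk fx κ Φ t p O.merged) (cOf κ Φ t p O (KS.gT mk gx) (KS.fT mk fx) cv) (hOf κ Φ t p O (KS.gT mk gx) (KS.fT mk fx) hv)).r 0 : ℤ) + 8 * KS.u₀A κ Φ t p O.merged (KS.gT mk gx κ Φ t p O.merged) (KS.fT mk fx κ Φ t p O.merged) + 8 + (fcellsV κ Φ t p O.merged (KS.gT mk gx κ Φ t p O.merged) (KS.fT mk fx κ Φ t p O.merged) (cOf κ Φ t p O (KS.gT mk gx) (KS.fT mk fx) cv) (hOf κ Φ t p O (KS.gT mk gx) (KS.fT mk fx) hv)).c 1 ≤ 5 * ((fcellsV κ Φ t p O.merged (KS.gT mk gx κ Φ t p O.merged) (KS.fT mk fx κ Φ t p O.merged) (cOf κ Φ t p O (KS.gT mk gx) (KS.fT mk fx) cv) (hOf κ Φ t p O (KS.gT mk gx) (KS.fT mk fx) hv)).r 0 : ℤ))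
    (hkE24 : 2 * (kEY + ((fcellsV κ Φ t p O.merged (KS.gT mk gx κ Φ t p O.merged) (KS.fT mk fx κ Φ t p O.merged) (cOf κ Φ t p O (KS.gT mk gx) (KS.fT mk fx) cv) (hOf κ Φ t p O (KS.gT mk gx) (KS.fT mk fx) hv)).r 0 : ℤ)) + 24 * KS.u₀A κ Φ t p O.merged (KS.gT mk gx κ Φ t p O.merged) (KS.fT mk fx κ Φ t p O.merged) + 24 + 2 * ((fcellsV κ Φ t p O.merged (KS.gT mk gx κ Φ t p O.merged) (KS.fT mk fx κ Φ t p O.merged) (cOf κ Φ t p O (KS.gT mk gx) (KS.fT mk fx) cv) (hOf κ Φ t p O (KS.gT mk gx) (KS.fT mk fx) hv)).c 1 : ℤ) ≤ 5 * ((fcellsV κ Φ t p O.merged (KS.gT mk gx κ Φ t p O.merged) (KS.fT mk fx κ Φ t p O.merged) (cOf κ Φ t p O (KS.gT mk gx) (KS.fT mk fx) cv) (hOf κ Φ t p O (KS.gT mk gx) (KS.fT mk fx) hv)).r 0 : ℤ))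
    (hfwdY : 2 * kEY + ((fcellsV κ Φ t p O.merged (KS.gT mk gx κ Φ t p O.merged) (KS.fT mk fx κ Φ t p O.merged) (cOf κ Φ t p O (KS.gT mk gx) (KS.fT mk fx) cv) (hOf κ Φ t p O (KS.gT mk gx) (KS.fT mk fx) hv)).hF 1 : ℤ) - (fcellsV κ Φ t p O.merged (KS.gT mk gx κ Φ t p O.merged) (KS.fT mk fx κ Φ t p O.merged) (cOf κ Φ t p O (KS.gT mk gx) (KS.fT mk fx) cv) (hOf κ Φ t p O (KS.gT mk gx) (KS.fT mk fx) hv)).hB 1 + 14 * KS.u₀A κ Φ t p O.merged (KS.gT mk gx κ Φ t p O.merged) (KS.fT mk fx κ Φ t p O.merged) ≤ 2 * (((fcellsV κ Φ t p O.merged (KS.gT mk gx κ Φ t p O.merged) (KS.fT mk fx κ Φ t p O.merged) (cOf κ Φ t p O (KS.gT mk gx) (KS.fT mk fx) cv) (hOf κ Φ t p O (KS.gT mk gx) (KS.fT mk fx) hv)).c 1 : ℤ) + (KS.bwY κ Φ t p O.merged (KS.gT mk gx κ Φ t p O.merged) (KS.fT mk fx κ Φ t p O.merged))))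
    (hfwdYx : 2 * kEY + ((fcellsV κ Φ t p O.merged (KS.gT mk gx κ Φ t p O.merged) (KS.fT mk fx κ Φ t p O.merged) (cOf κ Φ t p O (KS.gT mk gx) (KS.fT mk fx) cv) (hOf κ Φ t p O (KS.gT mk gx) (KS.fT mk fx) hv)).hF 1 : ℤ) - (fcellsV κ Φ t p O.merged (KS.gT mk gx κ Φ t p O.merged) (KS.fT mk fx κ Φ t p O.merged) (cOf κ Φ t p O (KS.gT mk gx) (KS.fT mk fx) cv) (hOf κ Φ t p O (KS.gT mk gx) (KS.fT mk fx) hv)).hB 1 + 24 * KS.u₀A κ Φ t p O.merged (KS.gT mk gx κ Φ t p O.merged) (KS.fT mk fx κ Φ t p O.merged) + 10 ≤ 2 * (((fcellsV κ Φ t p O.merged (KS.gT mk gx κ Φ t p O.merged) (KS.fT mk fx κ Φ t p O.merged) (cOf κ Φ t p O (KS.gT mk gx) (KS.fT mk fx) cv) (hOf κ Φ t p O (KS.gT mk gx) (KS.fT mk fx) hv)).c 1 : ℤ) + (KS.bwY κ Φ t p O.merged (KS.gT mk gx κ Φ t p O.merged) (KS.fT mk fx κ Φ t p O.merged))))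
    (hc600 : 600 * Neg.Kq κ ≤ cW)
    (hrX : KS.πBudX κ Φ t p O.merged cW mk (KS.gT mk gx κ Φ t p O.merged) (KS.fT mk fx κ Φ t p O.merged) ≤ r)
    (hrY : KS.πBudY κ Φ t p O.merged cW mk (KS.gT mk gx κ Φ t p O.merged) (KS.fT mk fx κ Φ t p O.merged) ≤ r)
    (hnB840 : 840 * Neg.Kq κ + 10 ≤ nB)
    -- (hp-8 g44) layer (a4)'s own node row: the bridge core's reach under the kit radius (`|core1Lo|₁ ≤ YbF ≤ r`)
    (hYbr : KS.YbF κ Φ t p O.merged cW mk (KS.gT mk gx κ Φ t p O.merged) (KS.fT mk fx κ Φ t p O.merged) ≤ r)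
    -- (hp-8 g44) layer (a5)'s own row: the stride budget under the chain length of record
    (hnBL : nB ≤ Lf κ.K₀) :
    Skelφ.FaceOblRMOF G ((choiceAtQ3V κ Φ t p Pv (KS.gT mk gx) (KS.fT mk fx) (SUS ex mx) cv hv BSlot.small3 hC).scheme O q)
      ((choiceAtQ3V κ Φ t p Pv (KS.gT mk gx) (KS.fT mk fx) (SUS ex mx) cv hv BSlot.small3 hC).FD O q) Φ.Δ κ.δ₂ := by
  have hAt3 := atQ3_of_atQ3V hAt
  have hAtT := atQ3T_of_atQ3 hAt3
  obtain ⟨hFN, hq1, hq2, hCq⟩ := factsNS_of_atQT hAtT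
  -- the bridge pair: `k < nBF`, the zone at the seed level inside the cylinder, orientation = the long pair's, served quadrant `1`
  have hkMu := hk_of_atQ hAt3
  have hnb : 1 ≤ (KS.nBF κ Φ t p O.merged cW mk) := by have := (KS.bF_facts κ Φ t p O.merged cW mk).1; have := (KS.RF2F κ Φ t p O.merged cW mk).1; omega
  have hMz : O.merged.k < (KS.nBF κ Φ t p O.merged cW mk) := by have := (KS.bF_facts κ Φ t p O.merged cW mk).1; have := (KS.RF2F κ Φ t p O.merged cW mk).1; have := hkMu.2; omega
  have hZ := fun c => zoneK_subset_cyl_φL hAt3 c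
  have hφ : oriφ Φ.φ (O.ori t (KS.MBF κ Φ t p O.merged cW mk) (KS.nBF κ Φ t p O.merged cW mk)) = (φL κ Φ t p O.D O.DT.toDataN O.ori (KS.gT mk gx κ Φ t p O.merged) (KS.fT mk fx κ Φ t p O.merged)) := congrArg (oriφ Φ.φ) (hFN.sel_ori _ _ _ _)
  have hBD := fun c c' => Skelφ.bridgeSets_same (G := G) (φ := (φL κ Φ t p O.D O.DT.toDataN O.ori (KS.gT mk gx κ Φ t p O.merged) (KS.fT mk fx κ Φ t p O.merged))) c (σ := 1) (Or.inl rfl) (KS.BFs κ Φ t p O.merged cW mk (KS.gT mk gx κ Φ t p O.merged) (KS.fT mk fx κ Φ t p O.merged) 1) (c := c') hnb (h := (KS.hBF κ Φ t p O.merged cW mk)) (ℓ := (KS.ℓBF κ Φ t p O.merged cW mk)) (Rb := (O.merged.R (O.merged.scale t (KS.MBF κ Φ t p O.merged cW mk) (KS.nBF κ Φ t p O.merged cW mk)))) (τ := 1)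
    (Or.inl rfl) le_rfl (by simp [KS.BFs, Skelφ.bridgeSame]) (by simp [KS.BFs, Skelφ.bridgeSame]) (hZ c') hMz
  have hsg1 : Skelφ.StepI.sgQ O.qd O.qdT O.ori t (KS.MBF κ Φ t p O.merged cW mk) (KS.nBF κ Φ t p O.merged cW mk) (0 : Fin 2) = 1 := sgQ_sel_eq_oneT hAtT _ _ 0
  have hbridgev : ∀ c', 1 - (Neg.δkit κ Φ) ^ 3 < (bondPercolation G q).real
      (linkIn (↑(pgramPrismFin G (φL κ Φ t p O.D O.DT.toDataN O.ori (KS.gT mk gx κ Φ t p O.merged) (KS.fT mk fx κ Φ t p O.merged)) c' (KS.nBF κ Φ t p O.merged cW mk) (KS.hBF κ Φ t p O.merged cW mk) (3 * (KS.ℓBF κ Φ t p O.merged cW mk)) (O.merged.R (O.merged.scale t (KS.MBF κ Φ t p O.merged cW mk) (KS.nBF κ Φ t p O.merged cW mk)))) : Set V) (O.merged.Λ c' O.merged.k) (pgSideHalfW G (φL κ Φ t p O.D O.DT.toDataN O.ori (KS.gT mk gx κ Φ t p O.merged) (KS.fT mk fx κ Φ t p O.merged)) c' (KS.nBF κ Φ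 t p O.merged cW mk) (KS.hBF κ Φ t p O.merged cW mk) (KS.ℓBF κ Φ t p O.merged cW mk) (O.merged.R (O.merged.scale t (KS.MBF κ Φ t p O.merged cW mk) (KS.nBF κ Φ t p O.merged cW mk))) 1 1)) := by
    intro c'
    have h := inputsPAt_cube_of_atQT hAtT h1 (le_refl (Neg.δkit κ Φ)) c' (Finset.mem_union_right _ hPx) (0 : Fin 2) 1
    rw [Skelφ.StepI.eventNAt_some, hsg1, hφ] at h
    unfold Skelφ.StepI.regionNAt Skelφ.StepI.pieceNAt at h
    rw [if_pos rfl] at h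
    rw [Skelφ.coe_pgramPrismFin']
    exact h
  exact faceOblRM_frmBVC₄ (Rb := (O.merged.R (O.merged.scale t (KS.MBF κ Φ t p O.merged cW mk) (KS.nBF κ Φ t p O.merged cW mk)))) mk cW gx fx hgx hfx ex mx hmx hAt h1 hp0 hp1 hMR0 hL' hRlr nB (hchain_of_chainFactQT Lf κ hCF (lt_of_le_of_lt hq2 hp1) (Neg.δkit_le_δr κ Φ (Nat.zero_le _)) hnBL r) hRb₀ hr₁R hRr₀ hr₂R hRsr hρr (fun c' : V => pgramPrismFin G (φL κ Φ t p O.D O.DT.toDataN O.ori (KS.gT mk gx κ Φ t p O.merged) (KS.fT mk fx κ Φ t p O.merged)) c' (KS.nBF κ Φ t p O.merged cW mk) (KS.hBF κ Φ t p O.merged cW mk) (3 * (KS.ℓBF κ Φ t p O.merged cW mk)) (O.merged.R (O.merged.scale t (KS.MBF κ Φ t p O.merged cW mk) (KS.nBF κ Φ t p O.merged cW mk)))) (fun c' : V => pgSideHalfW G (φL κ Φ t p O.D O.DT.toDataN O.ori (KS.gT mk gx κ Φ t p O.merged) (KS.fT mk fx κ Φ t p O.merged)) c' (KS.nBF κ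 Φ t p O.merged cW mk) (KS.hBF κ Φ t p O.merged cW mk) (KS.ℓBF κ Φ t p O.merged cW mk) (O.merged.R (O.merged.scale t (KS.MBF κ Φ t p O.merged cW mk) (KS.nBF κ Φ t p O.merged cW mk))) 1 1) (fun c c' w hw => (hBD c c').1 w hw) (fun c c' w hw => (hBD c c').2.1 w hw) hbridgev hR₁b hR₁r hr₀L hroomX hroomY hZk hkEr hkE2 hfwdX hkE hkE8 hkE24 hfwdY hfwdYx hc600 hrX hrY hnB840 hYbr

end NegB

end PlanarSkeletonFrm

end Summit.CriticalPhenomena.PercolationContinuityZ3.Theorems.Transplant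

end
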